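import Literature.NumberTheory.LFunctions.Zhang2022.DHChainBarrier

/-!
# Zhang (2022) / KILL(B-dh) §E target `DH.menuConsistent_holds` — row04 (Thorner–Zaman Thm 1.2 ∧ Cor 6.1 count bounds):
# the REAL-INEQUALITY HALF (casts and the four majorisations), from abstract count facts about a world

Cell `landau-siegel`, sub-cell E, stub S-E-p1-9 (ls-barrier-p1 with ls-Bdh-typer-2; proof map B-dh/SIGMA-E-HANDOVER.md v1
85415a87d174988f row04 + §28 d1–d2). **WHAT THIS IS NOT: no claim about Landau–Siegel zeros, about Theorems 1–2 of
arXiv:2211.02515, or about the truth of any analytic menu row; this file proves real inequalities and a transport lemma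
about an ABSTRACT `DH.ZeroWorld` — the consistency-model currency of the B-dh certificate (E-057 `DH.MenuConsistent`, a
bare `Prop` asserted by no one).**

`Menu.row04` (DHChainBarrier.lean :152) asks, for a world `w`, all `Q ≥ 3`:
`σ ≥ 39/40 ⇒ N(σ,Q) ≤ 10⁸⁸(10⁴²¹Q⁹⁹)^{1−σ} ∧ N*(σ,Q) ≤ 10⁹³·min 1 ((1 − β₁(Q)) log Q)·(10⁴⁶⁶Q¹⁷⁰)^{1−σ}` and the `σ ≥ 0` pair with
exponents `127 / 198` (`ThornerZaman2024` Thm 1.2 / Cor 6.1 as rendered). This file splits the row into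
(i) COUNT FACTS about the world (to be proved from p4's `DHMenuConsistentWorld` W1–W7 for `w = DH.world D χ`; here they are
the displayed hypotheses `hhalf`, `hhalfX`, `hlow`, `hlowX`, `hbeta` of `row04_of_counts`): above `Re = ½` at most ONE zero
(the exceptional `β₁ = betaExc D`, which is `betaOne Q` whenever it is counted, so the excluded count vanishes), below it
at most `Q⁴` zeros with `|Im| ≤ Q` in all primitive slots of level `≤ Q` together (the conductor fences: `Σ_{q ≤ Q} φ(q)·(2F_q(Q)+2)
≤ Q³ log Q + Q³ ≤ Q⁴`), and `β₁(Q) ∈ {0, betaExc D}` with `1 − betaExc D = 2/(3 (log D)^2022) ≥ 2/(3 (log Q)^2022)` when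
`D ≤ Q` (then `log Q ≥ log D ≥ 43250`); and (ii) the REAL INEQUALITIES turning (i) into the four bounds, proved here:
(private) `b^{1/2} ≤ b^{1−σ}` for `b ≥ 1`, `σ ≤ ½`, `Q^m ≤ (c·Q^k)^{1/2}` for `2m ≤ k`,
`log_pow_le_pow_of_large` (`(log Q)^2021 ≤ Q^95` for `log Q ≥ 43250` — the n2 line of the handover, no numerics needed),
and the transport **`row04_of_counts`**. The world half (i) is S-E-bd2-1 / the successor's (file `DHMenuConsistentRow04World`).
[cite: ThornerZaman2024LogFree, Thm 1.2, Cor 6.1; Zhang2022LandauSiegel, §2 Assumption (A)]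
-/

noncomputable section

open Real

namespace Literature.NumberTheory.LFunctions.Zhang2022.DH

/-! ### Real inequalities -/

/-- `b^{1/2} ≤ b^{1−σ}` for `b ≥ 1` and `σ ≤ 1/2`. [folklore] -/
private theorem rpow_half_le_rpow_one_sub {b σ : ℝ} (hb : 1 ≤ b) (hσ : σ ≤ 1 / 2) :
    b ^ (1 / 2 : ℝ) ≤ b ^ (1 - σ) :=
  Real.rpow_le_rpow_of_exponent_le hb (by linarith)

/-- `1 ≤ b^{1−σ}` for `b ≥ 1`, `σ ≤ 1`. [folklore] -/
private theorem one_le_rpow_one_sub {b σ : ℝ} (hb : 1 ≤ b) (hσ : σ ≤ 1) : 1 ≤ b ^ (1 - σ) :=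
  Real.one_le_rpow hb (by linarith)

/-- `Q^m ≤ (c·Q^k)^{1/2}` for `Q ≥ 1`, `c ≥ 1`, `2m ≤ k`. [folklore] -/
private theorem pow_le_rpow_half {Q c : ℝ} {m k : ℕ} (hQ : 1 ≤ Q) (hc : 1 ≤ c) (hk : 2 * m ≤ k) :
    Q ^ m ≤ (c * Q ^ k) ^ (1 / 2 : ℝ) := by
  have hQ0 : 0 ≤ Q := by linarith
  have h2 : Q ^ (2 * m) ≤ c * Q ^ k := by
    calc Q ^ (2 * m) ≤ Q ^ k := pow_le_pow_right₀ hQ hk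
      _ = 1 * Q ^ k := (one_mul _).symm
      _ ≤ c * Q ^ k := mul_le_mul_of_nonneg_right hc (by positivity)
  have e : Q ^ m = (Q ^ (2 * m)) ^ (1 / 2 : ℝ) := by
    rw [show (Q ^ (2 * m) : ℝ) = (Q ^ m) ^ 2 by ring, ← Real.sqrt_eq_rpow, Real.sqrt_sq (by positivity)]
  rw [e]
  exact Real.rpow_le_rpow (by positivity) h2 (by norm_num)

/-- **The n2 line without numerics**: `(log Q)^2021 ≤ Q^95` once `Q ≥ 3` and `log Q ≥ 43250` (indeed once `log Q ≳ 1815`):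
with `t = 95·log Q/2021 ≥ 2033`, `log Q = (2021/95)·t ≤ t²/4 ≤ e^t`, so `(log Q)^2021 ≤ e^{2021 t} = e^{95 log Q} = Q^95` — the
bookkeeping behind the exceptional factor `min 1 ((1 − β₁) log Q)` of Cor. 6.1 at `log Q ≥ 43250`. [cite: ThornerZaman2024LogFree, Cor 6.1] -/
theorem log_pow_le_pow_of_large {Q : ℝ} (hQ3 : 3 ≤ Q) (hQ : 43250 ≤ Real.log Q) : Real.log Q ^ 2021 ≤ Q ^ 95 := by
  set L := Real.log Q with hL
  have hL0 : 0 < L := by linarith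
  have hQ0 : 0 < Q := by linarith
  set t := 95 * L / 2021 with ht
  have ht0 : 2033 ≤ t := by rw [ht]; linarith
  have hexp : t ^ 2 / 4 ≤ Real.exp t := by
    have h1 : 1 + t / 2 ≤ Real.exp (t / 2) := by
      have := Real.add_one_le_exp (t / 2); linarith
    have h2 : 0 ≤ 1 + t / 2 := by linarith
    calc t ^ 2 / 4 ≤ (1 + t / 2) ^ 2 := by nlinarith
      _ ≤ Real.exp (t / 2) ^ 2 := pow_le_pow_left₀ h2 h1 2
      _ = Real.exp t := by rw [← Real.exp_nat_mul]; ring_nf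
  have hLt : L ≤ Real.exp t := by
    have : L = 2021 / 95 * t := by rw [ht]; ring
    rw [this]; nlinarith
  calc L ^ 2021 ≤ Real.exp t ^ 2021 := pow_le_pow_left₀ hL0.le hLt 2021
    _ = Real.exp (95 * L) := by rw [← Real.exp_nat_mul, ht]; ring_nf
    _ = Q ^ 95 := by
      rw [hL, show (95 : ℝ) * Real.log Q = ((95 : ℕ) : ℝ) * Real.log Q by norm_num, Real.exp_nat_mul,
        Real.exp_log hQ0]

/-- `1 < log 3` (`e < 3`). [folklore] -/
private theorem one_lt_log_three : (1 : ℝ) < Real.log 3 := by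
  rw [Real.lt_log_iff_exp_lt (by norm_num)]
  have := Real.exp_one_lt_d9; linarith

/-! ### The transport: abstract count facts ⇒ the four bounds of `Menu.row04` -/

/-- **Row04 from count facts.** For a zero world `w` in which (above `Re = ½`) at most one zero is counted and none once the
exceptional `β₁(Q)` is excluded, no zero has `Re ≥ 1`, at most `Q⁴` zeros in total are counted for `σ ≥ 0`, and `β₁(Q)` is
either `0` or within `2/(3 (log Q)^2022)` of `1` with `log Q ≥ 43250` — the shape of the (A)-world `DH.world D χ` (W1–W7) —
the four count bounds of `Menu.row04` (Thorner–Zaman Thm 1.2 / Cor 6.1 as rendered) hold. Pure real inequalities.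
[cite: ThornerZaman2024LogFree, Thm 1.2, Cor 6.1] -/
theorem row04_of_counts (w : ZeroWorld)
    (hone : ∀ Q σ : ℝ, 3 ≤ Q → 1 ≤ σ → w.zeroCount σ Q = 0)
    (hhalf : ∀ Q σ : ℝ, 3 ≤ Q → 1 / 2 ≤ σ → (w.zeroCount σ Q : ℝ) ≤ 1)
    (hhalfX : ∀ Q σ : ℝ, 3 ≤ Q → 1 / 2 ≤ σ → w.zeroCountExcl σ Q = 0)
    (hlow : ∀ Q σ : ℝ, 3 ≤ Q → (w.zeroCount σ Q : ℝ) ≤ Q ^ 4)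
    (hlowX : ∀ Q σ : ℝ, 3 ≤ Q → (w.zeroCountExcl σ Q : ℝ) ≤ Q ^ 4)
    (hbeta : ∀ Q : ℝ, 3 ≤ Q → w.betaOne Q = 0 ∨
      (43250 ≤ Real.log Q ∧ 2 / (3 * Real.log Q ^ 2022) ≤ 1 - w.betaOne Q ∧ w.betaOne Q ≤ 1)) :
    (∀ Q : ℝ, 3 ≤ Q → ∀ σ : ℝ, 39 / 40 ≤ σ →
      (w.zeroCount σ Q : ℝ) ≤ 10 ^ 88 * (10 ^ 421 * Q ^ 99) ^ (1 - σ) ∧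
        (w.zeroCountExcl σ Q : ℝ) ≤ 10 ^ 93 * min 1 ((1 - w.betaOne Q) * Real.log Q) * (10 ^ 466 * Q ^ 170) ^ (1 - σ)) ∧
    (∀ Q : ℝ, 3 ≤ Q → ∀ σ : ℝ, 0 ≤ σ →
      (w.zeroCount σ Q : ℝ) ≤ 10 ^ 88 * (10 ^ 421 * Q ^ 127) ^ (1 - σ) ∧
        (w.zeroCountExcl σ Q : ℝ) ≤ 10 ^ 93 * min 1 ((1 - w.betaOne Q) * Real.log Q) * (10 ^ 466 * Q ^ 198) ^ (1 - σ)) := by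
  -- common facts at a fixed `Q ≥ 3`
  have hminnn : ∀ Q : ℝ, 3 ≤ Q → 0 ≤ min 1 ((1 - w.betaOne Q) * Real.log Q) := by
    intro Q hQ
    have hlogQ : 0 < Real.log Q := Real.log_pos (by linarith)
    rcases hbeta Q hQ with h0 | ⟨_, hlo, _⟩
    · rw [h0, sub_zero, one_mul]; exact le_min zero_le_one hlogQ.le
    · have : 0 ≤ 1 - w.betaOne Q := le_trans (by positivity) hlo
      exact le_min zero_le_one (mul_nonneg this hlogQ.le)
  -- the high-σ bound on `zeroCount`, any exponent `k`
  have hhigh : ∀ (Q σ : ℝ) (a k : ℕ), 3 ≤ Q → 1 / 2 ≤ σ →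
      (w.zeroCount σ Q : ℝ) ≤ 10 ^ 88 * ((10:ℝ) ^ a * Q ^ k) ^ (1 - σ) := by
    intro Q σ a k hQ hσ
    have hb : 1 ≤ (10:ℝ) ^ a * Q ^ k := one_le_mul_of_one_le_of_one_le (one_le_pow₀ (by norm_num)) (one_le_pow₀ (by linarith))
    rcases le_or_gt 1 σ with h1 | h1
    · rw [hone Q σ hQ h1]; push_cast; positivity
    · calc (w.zeroCount σ Q : ℝ) ≤ 1 := hhalf Q σ hQ hσ
        _ ≤ 10 ^ 88 * 1 := by norm_num
        _ ≤ 10 ^ 88 * ((10:ℝ) ^ a * Q ^ k) ^ (1 - σ) :=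
          mul_le_mul_of_nonneg_left (one_le_rpow_one_sub hb h1.le) (by norm_num)
  -- the high-σ bound on `zeroCountExcl`
  have hhighX : ∀ (Q σ : ℝ) (a k : ℕ), 3 ≤ Q → 1 / 2 ≤ σ →
      (w.zeroCountExcl σ Q : ℝ) ≤ 10 ^ 93 * min 1 ((1 - w.betaOne Q) * Real.log Q) * ((10:ℝ) ^ a * Q ^ k) ^ (1 - σ) := by
    intro Q σ a k hQ hσ
    rw [hhalfX Q σ hQ hσ]; push_cast
    have := hminnn Q hQ
    positivity
  -- the low-σ bound on `zeroCount`
  have hlowb : ∀ (Q σ : ℝ) (a k : ℕ), 3 ≤ Q → σ < 1 / 2 → 8 ≤ k →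
      (w.zeroCount σ Q : ℝ) ≤ 10 ^ 88 * ((10:ℝ) ^ a * Q ^ k) ^ (1 - σ) := by
    intro Q σ a k hQ hσ hk
    have hc : 1 ≤ (10:ℝ) ^ a := one_le_pow₀ (by norm_num)
    have hb : 1 ≤ (10:ℝ) ^ a * Q ^ k := one_le_mul_of_one_le_of_one_le hc (one_le_pow₀ (by linarith))
    calc (w.zeroCount σ Q : ℝ) ≤ Q ^ 4 := hlow Q σ hQ
      _ ≤ ((10:ℝ) ^ a * Q ^ k) ^ (1 / 2 : ℝ) := pow_le_rpow_half (by linarith) hc (by omega)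
      _ ≤ ((10:ℝ) ^ a * Q ^ k) ^ (1 - σ) := rpow_half_le_rpow_one_sub hb hσ.le
      _ ≤ 10 ^ 88 * ((10:ℝ) ^ a * Q ^ k) ^ (1 - σ) := le_mul_of_one_le_left (by positivity) (by norm_num)
  -- the low-σ bound on `zeroCountExcl` (`k ≥ 198`, so that `Q^99 ≤ (…)^{1/2}`)
  have hlowXb : ∀ (Q σ : ℝ) (a k : ℕ), 3 ≤ Q → σ < 1 / 2 → 198 ≤ k →
      (w.zeroCountExcl σ Q : ℝ) ≤ 10 ^ 93 * min 1 ((1 - w.betaOne Q) * Real.log Q) * ((10:ℝ) ^ a * Q ^ k) ^ (1 - σ) := by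
    intro Q σ a k hQ hσ hk
    have hQ1 : 1 ≤ Q := by linarith
    have hlogQ : 1 < Real.log Q := lt_of_lt_of_le one_lt_log_three (Real.log_le_log (by norm_num) hQ)
    have hc : 1 ≤ (10:ℝ) ^ a := one_le_pow₀ (by norm_num)
    have hb : 1 ≤ (10:ℝ) ^ a * Q ^ k := one_le_mul_of_one_le_of_one_le hc (one_le_pow₀ hQ1)
    have h99 : Q ^ 99 ≤ ((10:ℝ) ^ a * Q ^ k) ^ (1 - σ) :=
      (pow_le_rpow_half hQ1 hc (by omega)).trans (rpow_half_le_rpow_one_sub hb hσ.le)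
    have hX := hlowX Q σ hQ
    rcases hbeta Q hQ with h0 | ⟨hL, hlo, hb1⟩
    · -- `β₁ = 0`: `min 1 (log Q) = 1`
      have hmin : min 1 ((1 - w.betaOne Q) * Real.log Q) = 1 := by
        rw [h0, sub_zero, one_mul]; exact min_eq_left hlogQ.le
      rw [hmin, mul_one]
      have hQ4 : Q ^ 4 ≤ Q ^ 99 := pow_le_pow_right₀ hQ1 (by norm_num)
      calc (w.zeroCountExcl σ Q : ℝ) ≤ Q ^ 99 := hX.trans hQ4
        _ ≤ ((10:ℝ) ^ a * Q ^ k) ^ (1 - σ) := h99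
        _ ≤ 10 ^ 93 * ((10:ℝ) ^ a * Q ^ k) ^ (1 - σ) := le_mul_of_one_le_left (by positivity) (by norm_num)
    · -- exceptional case: `min ≥ 2/(3 (log Q)^2021)` and `(log Q)^2021 ≤ Q^95`
      set L := Real.log Q with hLdef
      have hL0 : 0 < L := by linarith
      have hL2021 : 0 < L ^ 2021 := pow_pos hL0 _
      have hmin : 2 / (3 * L ^ 2021) ≤ min 1 ((1 - w.betaOne Q) * L) := by
        refine le_min ?_ ?_
        · rw [div_le_one (by positivity)]
          have : 1 ≤ L ^ 2021 := one_le_pow₀ hlogQ.le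
          linarith
        · have e : 2 / (3 * L ^ 2021) = 2 / (3 * L ^ 2022) * L := by
            field_simp
          rw [e]
          exact mul_le_mul_of_nonneg_right hlo hL0.le
      have hpow : L ^ 2021 ≤ Q ^ 95 := log_pow_le_pow_of_large hQ hL
      -- `Q^4 · (3 L^2021) ≤ 2 · 10^93 · Q^99`
      have hkey : (w.zeroCountExcl σ Q : ℝ) * (3 * L ^ 2021) ≤ 10 ^ 93 * 2 * Q ^ 99 := by
        have hQ95 : 0 ≤ Q ^ 95 := by positivity
        have hQ4 : 0 ≤ Q ^ 4 := by positivity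
        calc (w.zeroCountExcl σ Q : ℝ) * (3 * L ^ 2021) ≤ Q ^ 4 * (3 * Q ^ 95) := by
              apply mul_le_mul hX (by linarith) (by positivity) hQ4
          _ = 3 * Q ^ 99 := by ring
          _ ≤ 10 ^ 93 * 2 * Q ^ 99 := by nlinarith [pow_nonneg (by linarith : (0:ℝ) ≤ Q) 99]
      have hstep : (w.zeroCountExcl σ Q : ℝ) ≤ 10 ^ 93 * (2 / (3 * L ^ 2021)) * Q ^ 99 := by
        rw [show (10:ℝ) ^ 93 * (2 / (3 * L ^ 2021)) * Q ^ 99 = (10 ^ 93 * 2 * Q ^ 99) / (3 * L ^ 2021) by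
          field_simp]
        rw [le_div_iff₀ (by positivity)]
        exact hkey
      calc (w.zeroCountExcl σ Q : ℝ) ≤ 10 ^ 93 * (2 / (3 * L ^ 2021)) * Q ^ 99 := hstep
        _ ≤ 10 ^ 93 * min 1 ((1 - w.betaOne Q) * L) * Q ^ 99 := by
          apply mul_le_mul_of_nonneg_right _ (by positivity)
          exact mul_le_mul_of_nonneg_left hmin (by norm_num)
        _ ≤ 10 ^ 93 * min 1 ((1 - w.betaOne Q) * L) * ((10:ℝ) ^ a * Q ^ k) ^ (1 - σ) := by
          apply mul_le_mul_of_nonneg_left h99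
          exact mul_nonneg (by norm_num) (hminnn Q hQ)
  refine ⟨fun Q hQ σ hσ => ⟨?_, ?_⟩, fun Q hQ σ _ => ⟨?_, ?_⟩⟩
  · simpa using hhigh Q σ 421 99 hQ (by linarith)
  · simpa using hhighX Q σ 466 170 hQ (by linarith)
  · rcases lt_or_ge σ (1 / 2) with h | h
    · simpa using hlowb Q σ 421 127 hQ h (by norm_num)
    · simpa using hhigh Q σ 421 127 hQ h
  · rcases lt_or_ge σ (1 / 2) with h | h
    · simpa using hlowXb Q σ 466 198 hQ h (by norm_num)
    · simpa using hhighX Q σ 466 198 hQ h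

end Literature.NumberTheory.LFunctions.Zhang2022.DH
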